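import Literature.Geometry.Kaehler.ComplexTorusDivisorStabilizer
import Literature.Geometry.Kaehler.ComplexTorusAnalyticHypersurfaceSectionsBadLocus
import Literature.Geometry.Kaehler.ComplexTorusAnalyticSetsNull
import Literature.Geometry.Kaehler.ComplexTorusCycleClassMap
import HarnessLib

/-!
# The stabiliser `Stab(T)` of a holomorphic chain of a compact complex torus is a closed analytic,
# proper (for `T ≠ 0`) and Haar-null subgroup

Layer `Literature/Geometry/Kaehler`; lane `lit-hodgefound`, seat p07. Let `X = E/Λ` be a compact complex
torus of dimension `g`, `T = Σ k_j A_j` a holomorphic `d`-chain of `X` and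
`Stab(T) = {x ∈ X | t_x^* T = T}` its stabiliser under translations (`chainStabilizer Φ T`, an
`AddSubgroup` of `X`, skeleton row A2-160 `ComplexTorusDivisorStabilizer`, whose docstring lists
"Closedness of `Stab(T)` for a general chain `T`" under WHAT IS NOT HERE). This file supplies it:

* §1 **`mem_chainStabilizer_iff_forall_mem_components`** — `x ∈ Stab(T)` iff `mult_T(x + A) = mult_T(A)`
  for the (finitely many, `X` compact) COMPONENTS `A` of `T` only: a translation preserving the
  multiplicities of the components permutes the finite set of components (injective self-map of a finite
  set), so it also carries non-components to non-components.
* §2 **`isAnalyticSet_chainStabilizer`** — `Stab(T)` IS A CLOSED ANALYTIC SUBSET of `X`: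
  `Stab(T) = ⋂_{A} ⋃_{A' : k_{A'} = k_A} {x | x + A = A'}` over components `A, A'`, and each
  `{x | x + A = A'} = {x | x + A ⊆ A'} ∩ {x | A' ⊆ x + A}` is closed analytic — an intersection of
  translates, analytic by the Noetherian property of closed analytic subsets of the compact `X`
  [Chirka1989, §5.7 Theorem] (`isAnalyticSet_setOf_vadd_set_subset`, `isAnalyticSet_setOf_subset_vadd`);
  `isClosed_chainStabilizer`, `isCompact_chainStabilizer`.
* §3 **`chainStabilizer_ne_top`** — for `T ≠ 0` and `d < g`, `Stab(T) ≠ X` (else the finitely many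
  components, all translates of one of them, would cover `X`, but each is Haar-null,
  `volume_eq_zero_of_hasPureDim_lt` [Chirka1989, §3.7 Cor.]); hence **`volume_chainStabilizer_eq_zero`**,
  `interior_chainStabilizer_eq_empty` (`Stab(T)` is a proper closed analytic subset: Haar-null and nowhere
  dense, `volume_eq_zero_of_isAnalyticSet_of_ne_univ`).
* §4 `chainStabilizer_of` — for the chain `k·[Z]` (`k ≠ 0`) of an irreducible `Z`: `Stab(k[Z]) = {x | x + Z = Z}`,
  the set-theoretic stabiliser of `ComplexTorusAnalyticSetsNoetherian.isAnalyticSet_setOf_vadd_set_eq`.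

Source statements: [Lange2023AbelianVarietiesComplex, §2.1.1 (p. 78): "`t_x^* D = D − x`"; Prop. 2.1.7]
for the stabiliser of a divisor; [Chirka1989, §11.5 Def. (p. 130)] (chains, components, local finiteness),
[Chirka1989, §5.7 Theorem (p. 62)] (intersections of analytic sets), [Chirka1989, §3.7 Cor. (p. 39)]
(proper analytic subsets are Lebesgue-null). Theorems only; no definitions, no named facts.

## References

* [Lange2023AbelianVarietiesComplex] H. Lange, *Abelian Varieties over the Complex Numbers*, Springer
  2023, §2.1.1 (2.1) and Prop. 2.1.7 (pp. 78–79).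
* [Chirka1989] E. M. Chirka, *Complex Analytic Sets*, Kluwer 1989, §3.7 Cor. (p. 39), §5.7 Theorem
  (p. 62), §11.5 Def. (p. 130).
-/

open scoped Manifold Topology Pointwise
open MeasureTheory Set Function Filter Module

namespace Literature.Geometry.Kaehler
namespace ComplexTorus

universe u

variable {ι : Type*} [Fintype ι] {E : Type u} [NormedAddCommGroup E] [InnerProductSpace ℂ E]
  [FiniteDimensional ℂ E] [MeasurableSpace E] [BorelSpace E] {Φ : (ι → ℝ) ≃L[ℝ] E} {d : ℕ}

/-! ### §1 The stabiliser is determined on the components -/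

omit [Fintype ι] [FiniteDimensional ℂ E] [MeasurableSpace E] [BorelSpace E] in
/-- `x + A = x + B ⟹ A = B` for subsets of the torus. [folklore] -/
private theorem vadd_set_cancel {x : ComplexTorus Φ} {A B : Set (ComplexTorus Φ)} (h : x +ᵥ A = x +ᵥ B) :
    A = B := by
  have h' := congrArg (fun S : Set (ComplexTorus Φ) ↦ -x +ᵥ S) h
  simpa only [neg_vadd_vadd] using h'

omit [FiniteDimensional ℂ E] [MeasurableSpace E] [BorelSpace E] in
/-- **`x ∈ Stab(T)` iff `mult_T(x + A) = mult_T(A)` for every COMPONENT `A` of `T`.** (`⇐`: such an `x`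
maps the finite set of components injectively, hence bijectively, into itself, `A ↦ x + A`; so `x + Z`
is a component only if `Z` is, and both multiplicities vanish otherwise.)
[cite: Lange2023AbelianVarietiesComplex, §2.1.1 (2.1) (p. 78)] [cite: Chirka1989, §11.5 Def., p. 130] -/
theorem mem_chainStabilizer_iff_forall_mem_components {T : HolomorphicChain 𝓘(ℂ, E) (ComplexTorus Φ) d}
    {x : ComplexTorus Φ} :
    x ∈ chainStabilizer Φ T ↔ ∀ A ∈ T.components, T.mult (x +ᵥ A) = T.mult A := by
  refine ⟨fun hx A _ ↦ hx A, fun h Z ↦ ?_⟩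
  by_cases hZ : Z ∈ T.components
  · exact h Z hZ
  · -- `Z` is not a component; neither is `x + Z`
    have hZ0 : T.mult Z = 0 := by simpa [HolomorphicChain.mem_components_iff] using hZ
    rw [hZ0]
    by_contra hxZ
    -- the self-map `A ↦ x + A` of the finite set of components is injective, hence surjective
    have hfin := T.finite_components_of_compactSpace
    haveI : Finite T.components := hfin.to_subtype
    have hmaps : ∀ A : T.components, x +ᵥ (A : Set (ComplexTorus Φ)) ∈ T.components := fun A ↦ by
      rw [HolomorphicChain.mem_components_iff, h A A.2]
      exact A.2
    set f : T.components → T.components := fun A ↦ ⟨x +ᵥ (A : Set (ComplexTorus Φ)), hmaps A⟩ with hf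
    have hinj : Injective f := by
      intro A B hAB
      have h1 : x +ᵥ (A : Set (ComplexTorus Φ)) = x +ᵥ (B : Set (ComplexTorus Φ)) :=
        congrArg (fun C : T.components ↦ (C : Set (ComplexTorus Φ))) hAB
      exact Subtype.ext (vadd_set_cancel h1)
    obtain ⟨A, hA⟩ := (Finite.surjective_of_injective hinj) ⟨x +ᵥ Z, hxZ⟩
    have hAZ : (A : Set (ComplexTorus Φ)) = Z :=
      vadd_set_cancel (congrArg (fun C : T.components ↦ (C : Set (ComplexTorus Φ))) hA)
    exact hZ (hAZ ▸ A.2)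

omit [FiniteDimensional ℂ E] [MeasurableSpace E] [BorelSpace E] in
/-- For a component `A`: `mult_T(x + A) = mult_T(A)` iff `x + A` is a component `A'` with `k_{A'} = k_A`.
[cite: Chirka1989, §11.5 Def., p. 130] -/
theorem setOf_mult_vadd_eq_eq_biUnion {T : HolomorphicChain 𝓘(ℂ, E) (ComplexTorus Φ) d}
    {A : Set (ComplexTorus Φ)} (hA : A ∈ T.components) :
    {x : ComplexTorus Φ | T.mult (x +ᵥ A) = T.mult A} =
      ⋃ A' ∈ {A' ∈ T.components | T.mult A' = T.mult A}, {x : ComplexTorus Φ | x +ᵥ A = A'} := by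
  ext x
  simp only [mem_setOf_eq, mem_iUnion, HolomorphicChain.mem_components_iff, exists_prop]
  constructor
  · intro hx
    refine ⟨x +ᵥ A, ⟨?_, hx⟩, rfl⟩
    rw [hx]
    exact hA
  · rintro ⟨A', ⟨-, hA'⟩, rfl⟩
    exact hA'

/-! ### §2 `Stab(T)` is a closed analytic subset of `X` -/

omit [MeasurableSpace E] [BorelSpace E] in
/-- **`{x ∈ X | x + Z = W}` is closed analytic** for closed analytic `Z, W ⊆ X`
(`= {x | x + Z ⊆ W} ∩ {x | W ⊆ x + Z}`, two intersections of translates). [cite: Chirka1989, §5.7 Theorem, p. 62] -/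
theorem isAnalyticSet_setOf_vadd_set_eq_of_isAnalyticSet (Φ : (ι → ℝ) ≃L[ℝ] E) {Z W : Set (ComplexTorus Φ)}
    (hZ : IsAnalyticSet 𝓘(ℂ, E) Z) (hW : IsAnalyticSet 𝓘(ℂ, E) W) :
    IsAnalyticSet 𝓘(ℂ, E) {x : ComplexTorus Φ | x +ᵥ Z = W} := by
  have h : {x : ComplexTorus Φ | x +ᵥ Z = W} =
      {x : ComplexTorus Φ | x +ᵥ Z ⊆ W} ∩ {x : ComplexTorus Φ | W ⊆ x +ᵥ Z} := by
    ext x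
    simp only [mem_setOf_eq, mem_inter_iff, Set.Subset.antisymm_iff]
  rw [h]
  exact (isAnalyticSet_setOf_vadd_set_subset Φ Z hW).inter (isAnalyticSet_setOf_subset_vadd Φ W hZ)

omit [MeasurableSpace E] [BorelSpace E] in
/-- **THE STABILISER OF A HOLOMORPHIC CHAIN IS A CLOSED ANALYTIC SUBSET OF `X`**:
`Stab(T) = ⋂_A ⋃_{A' : k_{A'} = k_A} {x | x + A = A'}` over the finitely many components.
[cite: Lange2023AbelianVarietiesComplex, §2.1.1 (2.1) and Prop. 2.1.7 (pp. 78–79)]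
[cite: Chirka1989, §5.7 Theorem, p. 62] -/
theorem isAnalyticSet_chainStabilizer (T : HolomorphicChain 𝓘(ℂ, E) (ComplexTorus Φ) d) :
    IsAnalyticSet 𝓘(ℂ, E) (chainStabilizer Φ T : Set (ComplexTorus Φ)) := by
  have hfin := T.finite_components_of_compactSpace
  have hset : (chainStabilizer Φ T : Set (ComplexTorus Φ)) =
      ⋂ A ∈ hfin.toFinset, {x : ComplexTorus Φ | T.mult (x +ᵥ A) = T.mult A} := by
    ext x
    simp only [SetLike.mem_coe, mem_chainStabilizer_iff_forall_mem_components, mem_iInter,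
      Set.Finite.mem_toFinset, mem_setOf_eq]
  rw [hset]
  refine isAnalyticSet_biInter_finset _ fun A hA ↦ ?_
  rw [Set.Finite.mem_toFinset] at hA
  have hfin' : {A' ∈ T.components | T.mult A' = T.mult A}.Finite := hfin.subset (sep_subset _ _)
  rw [setOf_mult_vadd_eq_eq_biUnion hA, ← hfin'.coe_toFinset, Finset.set_biUnion_coe]
  refine isAnalyticSet_biUnion_finset _ fun A' hA' ↦ ?_
  rw [Set.Finite.mem_toFinset] at hA'
  exact isAnalyticSet_setOf_vadd_set_eq_of_isAnalyticSet Φ (T.isIrreducibleAnalyticSet_of_mult_ne_zero hA).1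
    (T.isIrreducibleAnalyticSet_of_mult_ne_zero hA'.1).1

omit [MeasurableSpace E] [BorelSpace E] in
/-- **`Stab(T)` is closed.** [cite: Lange2023AbelianVarietiesComplex, §2.1.1 Prop. 2.1.7 (p. 79)] -/
theorem isClosed_chainStabilizer (T : HolomorphicChain 𝓘(ℂ, E) (ComplexTorus Φ) d) :
    IsClosed (chainStabilizer Φ T : Set (ComplexTorus Φ)) :=
  (isAnalyticSet_chainStabilizer T).isClosed

omit [MeasurableSpace E] [BorelSpace E] in
/-- **`Stab(T)` is compact.** [cite: Lange2023AbelianVarietiesComplex, §2.1.1 Prop. 2.1.7 (p. 79)] -/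
theorem isCompact_chainStabilizer (T : HolomorphicChain 𝓘(ℂ, E) (ComplexTorus Φ) d) :
    IsCompact (chainStabilizer Φ T : Set (ComplexTorus Φ)) :=
  (isClosed_chainStabilizer T).isCompact

/-! ### §3 `Stab(T)` is proper and Haar-null for `T ≠ 0` -/

/-- **`Stab(T) ≠ X` for a non-zero `d`-chain with `d < g`**: otherwise all translates of a component `A`
are components, finitely many Haar-null sets covering `X`.
[cite: Lange2023AbelianVarietiesComplex, §2.1.1 Prop. 2.1.7 (p. 79)]
[cite: Chirka1989, §3.7 Cor., p. 39] -/
theorem chainStabilizer_ne_top (hd : d < finrank ℂ E) {T : HolomorphicChain 𝓘(ℂ, E) (ComplexTorus Φ) d}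
    (hT : T ≠ 0) : chainStabilizer Φ T ≠ ⊤ := by
  intro htop
  -- a component `A` and a point `a ∈ A`
  have hne : ∃ A, T.mult A ≠ 0 := by
    by_contra h
    push Not at h
    exact hT (HolomorphicChain.mult_injective (funext fun Z ↦ by rw [h Z, HolomorphicChain.mult_zero]; rfl))
  obtain ⟨A, hA⟩ := hne
  obtain ⟨a, ha⟩ := (T.hasPureDim_of_mult_ne_zero hA).nonempty
  have hfin := T.finite_components_of_compactSpace
  -- every point lies on a translate `x + A`, which is a component
  have hcover : (univ : Set (ComplexTorus Φ)) ⊆ ⋃ W ∈ T.components, W := by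
    intro y _
    have hx : (y - a) ∈ chainStabilizer Φ T := by rw [htop]; exact AddSubgroup.mem_top _
    have hmem : (y - a) +ᵥ A ∈ T.components := by
      rw [HolomorphicChain.mem_components_iff, hx A]
      exact hA
    exact mem_biUnion hmem (Set.mem_vadd_set.2 ⟨a, ha, by rw [vadd_eq_add, sub_add_cancel]⟩)
  -- but every component is Haar-null
  have hnull : (volume : Measure (ComplexTorus Φ)) (⋃ W ∈ T.components, W) = 0 :=
    (measure_biUnion_null_iff hfin.countable).2 fun W hW ↦
      volume_eq_zero_of_hasPureDim_lt Φ (T.hasPureDim_of_mult_ne_zero hW) hd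
  have h1 : (volume : Measure (ComplexTorus Φ)) univ = 0 := measure_mono_null hcover hnull
  rw [measure_univ] at h1
  exact one_ne_zero h1

/-- **`Stab(T)` IS HAAR-NULL** for a non-zero `d`-chain, `d < g` (a proper closed analytic subset of `X`).
[cite: Lange2023AbelianVarietiesComplex, §2.1.1 Prop. 2.1.7 (p. 79)] [cite: Chirka1989, §3.7 Cor., p. 39] -/
theorem volume_chainStabilizer_eq_zero (hd : d < finrank ℂ E) {T : HolomorphicChain 𝓘(ℂ, E) (ComplexTorus Φ) d}
    (hT : T ≠ 0) : (volume : Measure (ComplexTorus Φ)) (chainStabilizer Φ T : Set (ComplexTorus Φ)) = 0 :=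
  volume_eq_zero_of_isAnalyticSet_of_ne_univ Φ (isAnalyticSet_chainStabilizer T) fun h ↦
    chainStabilizer_ne_top hd hT (SetLike.coe_injective (by rw [h, AddSubgroup.coe_top]))

/-- **`Stab(T)` has empty interior** (is nowhere dense) for a non-zero `d`-chain, `d < g`.
[cite: Lange2023AbelianVarietiesComplex, §2.1.1 Prop. 2.1.7 (p. 79)] [cite: Chirka1989, §2.2 Cor., p. 21] -/
theorem interior_chainStabilizer_eq_empty (hd : d < finrank ℂ E)
    {T : HolomorphicChain 𝓘(ℂ, E) (ComplexTorus Φ) d} (hT : T ≠ 0) :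
    interior (chainStabilizer Φ T : Set (ComplexTorus Φ)) = ∅ :=
  interior_eq_empty_of_isAnalyticSet_of_ne_univ Φ (isAnalyticSet_chainStabilizer T) fun h ↦
    chainStabilizer_ne_top hd hT (SetLike.coe_injective (by rw [h, AddSubgroup.coe_top]))

/-! ### §4 The stabiliser of `k·[Z]` is the set-theoretic stabiliser of `Z` -/

omit [FiniteDimensional ℂ E] [MeasurableSpace E] [BorelSpace E] in
/-- **`Stab(k[Z]) = {x | x + Z = Z}`** for an irreducible `Z` of pure dimension `d` and `k ≠ 0`.
[cite: Lange2023AbelianVarietiesComplex, §2.1.1 (2.1) (p. 78)] [cite: Chirka1989, §11.5 Def., p. 130] -/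
theorem coe_chainStabilizer_of {Z : Set (ComplexTorus Φ)} (hZ : IsIrreducibleAnalyticSet 𝓘(ℂ, E) Z)
    (hZd : HasPureDim 𝓘(ℂ, E) Z d) {k : ℤ} (hk : k ≠ 0) :
    (chainStabilizer Φ (HolomorphicChain.of Z hZ hZd k) : Set (ComplexTorus Φ)) =
      {x : ComplexTorus Φ | x +ᵥ Z = Z} := by
  have hcomp : (HolomorphicChain.of Z hZ hZd k).components = {Z} := by
    refine Subset.antisymm (HolomorphicChain.components_of_subset hZ hZd k) ?_
    rintro _ rfl
    rw [HolomorphicChain.mem_components_iff, HolomorphicChain.mult_of_self]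
    exact hk
  ext x
  simp only [SetLike.mem_coe, mem_chainStabilizer_iff_forall_mem_components, hcomp, mem_singleton_iff,
    forall_eq, HolomorphicChain.mult_of_self, mem_setOf_eq]
  constructor
  · intro h
    by_contra hne
    rw [HolomorphicChain.mult_of_of_ne hZ hZd k hne] at h
    exact hk h.symm
  · intro h
    rw [h, HolomorphicChain.mult_of_self]

end ComplexTorus

end Literature.Geometry.Kaehler
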